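/-
Copyright (c) 2026 the pub-hodgecm-mathlib formalisation cell (harness21).  Prover seat hodgecm-mathlib-K2E1-p15 (g0), Track B ∕ K2-LIT «5Res», h413 = `stmt-HodgeConjecture-24833`,
line `K2_E1_TraceFormulaBeta`, route of record `HCCMUnconditional`; K2E1-p10 (g2)'s F3d chain, brick F3d-δ (spec `K2/STATUS.md` 2026-09-04T12:53:06Z): «the Eisenstein class of a
NICE Borel-side function is an honest bounded measurable `L²` class».
-/
import Summits.HodgeConjecture.HodgeConjecture.Theorems.K2E1ChiEisensteinMemHXCMTwo           -- ★ (K2E4-p23): `measurable_quotFun_eisensteinSeriesU_of_borel_invariant_cm_two` (+ ★ RegularU `continuous_eisensteinSeriesU_flatSectionU_cm_two`, ★ `measurable_quotFun_of_measurable`)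
import Summits.HodgeConjecture.HodgeConjecture.Theorems.K2E1EisensteinSupNormBandBoundCMTwo    -- ★ p860289 (K2E1-p10) F3d-γ: `exists_const_norm_eisensteinSeriesU_le_cm` (+ ★ `forall_arithmeticBorel_iff`)
import Summits.HodgeConjecture.HodgeConjecture.Theorems.K2E1SphericalHeckeEigenSectionU2       -- ★ (K2E1-p11): `continuous_borelHeight_cpow`, `norm_borelHeight_cpow`, `borelHeight_coe_pos`
import HarnessLib

/-!
# K2·E1 — `K2E1EisensteinNiceClassCMTwo`: THE EISENSTEIN CLASS OF A NICE BOREL-SIDE FUNCTION IS A BOUNDED MEASURABLE `L^p` CLASS (F3d-δ of K2E1-p10's C7 chain; CM pair, `N = 2`)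

Track B ∕ K2-LIT, crux h413 = `stmt-HodgeConjecture-24833`; cell `hodgecm-mathlib`, squad K2, ENGINE E1, ROADCARD C7 (b)(c) «families».  THEOREMS ONLY (no `def`, no `instance`, no
notation, no named-fact hypothesis, no `sorry`); lane `--kind proof --supports stmt-HodgeConjecture-24833 --as helper` (count-neutral).  Closes no socket.

WHAT ([MoeglinWaldspurger1995, II.1.2–II.1.3, I.2.13]).  A NICE Borel-side function `u : U(1,1)(𝔸_{L⁺}) → ℂ` — continuous, left-`B(F)`-invariant, bounded (`‖u‖ ≤ M`), supported in a
HEIGHT BAND `a ≤ H ≤ b` with `a > 0` (the periodisation `ψ` of a nice test function, ★ F3b′ p860301 (L1)–(L4)) — is the FLAT SECTION `f_2^{φ}` of the bounded continuous coefficient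
`φ = H^{−2}·u` (§1), so the unconditional `N = 2` Godement machinery at `z = 2` (`1 < Re z`) applies: `E(u)` is continuous (★ `continuous_eisensteinSeriesU_flatSectionU_cm_two`), its
descent `quotFun (E u)` to `𝔛` is Borel (★ `measurable_quotFun_eisensteinSeriesU_of_borel_invariant_cm_two`), `E(u)` is BOUNDED (the band makes the Eisenstein sum uniformly finite:
★ F3d-γ `exists_const_norm_eisensteinSeriesU_le_cm`), hence `quotFun (E u) ∈ L^p(𝔛, μ)` for every finite `μ` and every `p` (★ `memLp_quotFun_of_bound`) — the `hv` binder of the C7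
HEAD's generators.
* §1 (generic `(F, E, c, N)`) **`eq_flatSectionU_two`** (`u = flatSectionU (H^{−2}·u) 2`), `continuous_heightCoeff`, `norm_heightCoeff_le` (`‖H^{−2}u‖ ≤ a^{−2}·M` on a band), the
  `B(F)`-invariance of the coefficient in both spellings.
* §2 (CM, `N = 2`) **`continuous_eisensteinSeriesU_of_nice`** (δ2), **`measurable_quotFun_eisensteinSeriesU_of_nice`** (δ3), **`exists_bound_eisensteinSeriesU_of_nice`** (δ4),
  **`memLp_quotFun_eisensteinSeriesU_of_nice`** (δ5).

HONEST LABEL: HC_CM is proved only modulo the 7 printed citations (2 remaining named inputs: hLiu418 = `stmt-HodgeConjecture-24832`, h413 = `stmt-HodgeConjecture-24833`) until rung 0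
closes; this file asserts no named fact and closes no socket.

## References
* [MoeglinWaldspurger1995] C. Mœglin, J.-L. Waldspurger, *Spectral decomposition and Eisenstein series* (1995), I.2.13, II.1.2–II.1.3, II.1.5.
* [Garrett2018] P. Garrett, *Modern Analysis of Automorphic Forms by Example* (2018), §2.2, §2.10.
* [Godement1966] R. Godement, *The spectral decomposition of cusp-forms*, Proc. Sympos. Pure Math. IX (1966), §3.
-/

set_option autoImplicit false
set_option linter.dupNamespace false  -- the mandated namespace repeats the summit's segment (`HodgeConjecture.HodgeConjecture`)

noncomputable section

open MeasureTheory Set Filter Topology NumberField Complex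
open scoped NNReal ENNReal
open Literature.NumberTheory.Automorphic Literature.NumberTheory.Automorphic.UnitaryGroup AdelicGroupData
open Summit.HodgeConjecture.HodgeConjecture.Cruxes.H413.K2E1BorelEisensteinU
open Summit.HodgeConjecture.HodgeConjecture.Cruxes.H413.K2E1BorelCosetsDictionary (forall_arithmeticBorel_iff)
open Summit.HodgeConjecture.HodgeConjecture.Cruxes.H413.K2E1BorelEisensteinRegularU (continuous_eisensteinSeriesU_flatSectionU_cm_two)
open Summit.HodgeConjecture.HodgeConjecture.Cruxes.H413.K2E1SphericalHeckeEigenSectionU2 (continuous_borelHeight_cpow norm_borelHeight_cpow borelHeight_coe_pos)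
open Summit.HodgeConjecture.HodgeConjecture.Cruxes.H413.K2E1ChiEisensteinMemHXCMTwo (measurable_quotFun_eisensteinSeriesU_of_borel_invariant_cm_two)
open Summit.HodgeConjecture.HodgeConjecture.Cruxes.H413.K2E1EisensteinSupNormBandBoundCMTwo (exists_const_norm_eisensteinSeriesU_le_cm)
open Summit.HodgeConjecture.HodgeConjecture.Cruxes.H413.K2E1TruncatedEisensteinL2 (memLp_quotFun_of_bound)

namespace Summit.HodgeConjecture.HodgeConjecture.Cruxes.H413.K2E1EisensteinNiceClassCMTwo

/-! ## §1 A band function is the flat section `f_2^{H^{−2}u}` -/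

section Generic

variable {F E : Type} [Field F] [NumberField F] [Field E] [NumberField E] [Algebra F E] {c : E ≃ₐ[F] E} {N : ℕ} [NeZero N]

/-- **`u = flatSectionU (H^{−2}·u) 2`** (`H > 0`, `H^{−2}·H^{2} = 1`). [cite: MoeglinWaldspurger1995, II.1.2] -/
theorem eq_flatSectionU_two (u : (quasiSplit F E c N).Adelic → ℂ) :
    u = flatSectionU (fun g : (quasiSplit F E c N).Adelic => (((borelHeight g : ℝ≥0) : ℝ) : ℂ) ^ (-(2 : ℂ)) * u g) 2 := by
  funext g
  have hH : (((borelHeight g : ℝ≥0) : ℝ) : ℂ) ≠ 0 := ofReal_ne_zero.2 (ne_of_gt (borelHeight_coe_pos g))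
  rw [flatSectionU_apply, mul_comm (_ ^ _) (u g), mul_assoc, ← cpow_add _ _ hH, neg_add_cancel, cpow_zero, mul_one]

/-- The coefficient `H^{−2}·u` is continuous for `u` continuous. [folklore] -/
theorem continuous_heightCoeff {u : (quasiSplit F E c N).Adelic → ℂ} (huc : Continuous u) :
    Continuous fun g : (quasiSplit F E c N).Adelic => (((borelHeight g : ℝ≥0) : ℝ) : ℂ) ^ (-(2 : ℂ)) * u g :=
  (continuous_borelHeight_cpow (-(2 : ℂ))).mul huc

/-- **`‖H^{−2}·u‖ ≤ a^{−2}·M`** for `‖u‖ ≤ M` supported where `a ≤ H` (`a > 0`). [cite: MoeglinWaldspurger1995, II.1.3] -/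
theorem norm_heightCoeff_le {u : (quasiSplit F E c N).Adelic → ℂ} {M : ℝ} (huM : ∀ g, ‖u g‖ ≤ M) {a b : ℝ≥0} (ha : 0 < a)
    (hband : ∀ g, u g ≠ 0 → a ≤ borelHeight g ∧ borelHeight g ≤ b) (g : (quasiSplit F E c N).Adelic) :
    ‖(((borelHeight g : ℝ≥0) : ℝ) : ℂ) ^ (-(2 : ℂ)) * u g‖ ≤ ((a : ℝ)) ^ (-(2 : ℝ)) * M := by
  have hM : 0 ≤ M := (norm_nonneg _).trans (huM g)
  by_cases hu : u g = 0
  · rw [hu, mul_zero, norm_zero]; positivity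
  · rw [norm_mul, norm_borelHeight_cpow]
    refine mul_le_mul ?_ (huM g) (norm_nonneg _) (by positivity)
    rw [show (-(2 : ℂ)).re = -(2 : ℝ) by norm_num]
    exact Real.rpow_le_rpow_of_nonpos (NNReal.coe_pos.2 ha) (NNReal.coe_le_coe.2 (hband g hu).1) (by norm_num)

/-- The coefficient `H^{−2}·u` is left-`B(F)`-invariant if `u` is (arithmetic spelling; ★ `borelHeight_arithmeticBorel_mul`). [cite: Garrett2018, §2.2] -/
theorem heightCoeff_arithmeticBorel_mul {u : (quasiSplit F E c N).Adelic → ℂ}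
    (huB : ∀ b ∈ arithmeticBorel F E c N, ∀ g : (quasiSplit F E c N).Adelic, u ((b : (quasiSplit F E c N).Adelic) * g) = u g) :
    ∀ b ∈ arithmeticBorel F E c N, ∀ g : (quasiSplit F E c N).Adelic,
      (fun g : (quasiSplit F E c N).Adelic => (((borelHeight g : ℝ≥0) : ℝ) : ℂ) ^ (-(2 : ℂ)) * u g) ((b : (quasiSplit F E c N).Adelic) * g) =
        (fun g : (quasiSplit F E c N).Adelic => (((borelHeight g : ℝ≥0) : ℝ) : ℂ) ^ (-(2 : ℂ)) * u g) g := fun b hb g => by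
  simp only [K2E1TruncatedEisensteinExplicit.borelHeight_arithmeticBorel_mul hb, huB b hb g]

/-- The coefficient `H^{−2}·u` is left-`B(F)`-invariant in the `borelU` spelling of ★ `eisensteinSeriesU` (★ `forall_arithmeticBorel_iff`). [cite: Garrett2018, §2.2] -/
theorem heightCoeff_borelU_mul {u : (quasiSplit F E c N).Adelic → ℂ}
    (huB : ∀ b ∈ arithmeticBorel F E c N, ∀ g : (quasiSplit F E c N).Adelic, u ((b : (quasiSplit F E c N).Adelic) * g) = u g) :
    ∀ b ∈ borelU (c : E →+* E) ((StdForm.antidiagonal N).over E), ∀ x : (quasiSplit F E c N).Adelic,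
      (fun g : (quasiSplit F E c N).Adelic => (((borelHeight g : ℝ≥0) : ℝ) : ℂ) ^ (-(2 : ℂ)) * u g) ((quasiSplit F E c N).toAdelic b * x) =
        (fun g : (quasiSplit F E c N).Adelic => (((borelHeight g : ℝ≥0) : ℝ) : ℂ) ^ (-(2 : ℂ)) * u g) x :=
  (forall_arithmeticBorel_iff (ψ := fun g : (quasiSplit F E c N).Adelic => (((borelHeight g : ℝ≥0) : ℝ) : ℂ) ^ (-(2 : ℂ)) * u g)).1 (heightCoeff_arithmeticBorel_mul huB)

end Generic

/-! ## §2 The Eisenstein class of a nice function on `U(1,1)_{L∕L⁺}` -/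

section CM

variable (L : Type) [Field L] [NumberField L] [IsCMField L]

/-- (δ2) **`E(u)` IS CONTINUOUS** for a nice `u` (continuous, bounded, band-supported): `u = f_2^{H^{−2}u}` with a bounded continuous coefficient and `1 < Re 2` (★
`continuous_eisensteinSeriesU_flatSectionU_cm_two`). [cite: MoeglinWaldspurger1995, II.1.5] [cite: Godement1966, §3] -/
theorem continuous_eisensteinSeriesU_of_nice {u : (quasiSplit (↥(maximalRealSubfield L)) L (IsCMField.complexConj L) 2).Adelic → ℂ} (huc : Continuous u)
    {M : ℝ} (huM : ∀ g, ‖u g‖ ≤ M) {a b : ℝ≥0} (ha : 0 < a) (hband : ∀ g, u g ≠ 0 → a ≤ borelHeight g ∧ borelHeight g ≤ b) :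
    Continuous (eisensteinSeriesU u) := by
  have h := continuous_eisensteinSeriesU_flatSectionU_cm_two L (z := 2) (by norm_num) (continuous_heightCoeff huc) (norm_heightCoeff_le huM ha hband)
  rwa [← eq_flatSectionU_two u] at h

variable [MeasurableSpace (quasiSplit (↥(maximalRealSubfield L)) L (IsCMField.complexConj L) 2).Adelic] [BorelSpace (quasiSplit (↥(maximalRealSubfield L)) L (IsCMField.complexConj L) 2).Adelic]

/-- (δ3) **`quotFun (E u)` IS BOREL ON `𝔛`** for a nice left-`B(F)`-invariant `u` (★ `measurable_quotFun_eisensteinSeriesU_of_borel_invariant_cm_two` at `z = 2` for the coefficient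
`H^{−2}u`). [cite: MoeglinWaldspurger1995, I.2.13, II.1.5] -/
theorem measurable_quotFun_eisensteinSeriesU_of_nice {u : (quasiSplit (↥(maximalRealSubfield L)) L (IsCMField.complexConj L) 2).Adelic → ℂ} (huc : Continuous u)
    (huB : ∀ b ∈ arithmeticBorel (↥(maximalRealSubfield L)) L (IsCMField.complexConj L) 2, ∀ g, u ((b : (quasiSplit (↥(maximalRealSubfield L)) L (IsCMField.complexConj L) 2).Adelic) * g) = u g)
    {M : ℝ} (huM : ∀ g, ‖u g‖ ≤ M) {a b : ℝ≥0} (ha : 0 < a) (hband : ∀ g, u g ≠ 0 → a ≤ borelHeight g ∧ borelHeight g ≤ b) :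
    Measurable ((quasiSplit (↥(maximalRealSubfield L)) L (IsCMField.complexConj L) 2).quotFun (eisensteinSeriesU u)) := by
  have h := measurable_quotFun_eisensteinSeriesU_of_borel_invariant_cm_two L (z := 2) (continuous_heightCoeff huc) (norm_heightCoeff_le huM ha hband)
    (heightCoeff_borelU_mul huB) (by norm_num)
  rwa [← eq_flatSectionU_two u] at h

omit [MeasurableSpace (quasiSplit (↥(maximalRealSubfield L)) L (IsCMField.complexConj L) 2).Adelic] [BorelSpace (quasiSplit (↥(maximalRealSubfield L)) L (IsCMField.complexConj L) 2).Adelic] in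
/-- (δ4) **`E(u)` IS BOUNDED** for a nice left-`B(F)`-invariant `u`: `u` vanishes below the height `a∕2 < a`, so ★ F3d-γ `exists_const_norm_eisensteinSeriesU_le_cm` (the uniform count of
`B(F)`-cosets above a height) gives `‖E(u)‖ ≤ C·M`. [cite: MoeglinWaldspurger1995, II.1.3] [cite: Garrett2018, §2.10] -/
theorem exists_bound_eisensteinSeriesU_of_nice {u : (quasiSplit (↥(maximalRealSubfield L)) L (IsCMField.complexConj L) 2).Adelic → ℂ}
    (huB : ∀ b ∈ arithmeticBorel (↥(maximalRealSubfield L)) L (IsCMField.complexConj L) 2, ∀ g, u ((b : (quasiSplit (↥(maximalRealSubfield L)) L (IsCMField.complexConj L) 2).Adelic) * g) = u g)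
    {M : ℝ} (huM : ∀ g, ‖u g‖ ≤ M) {a b : ℝ≥0} (ha : 0 < a) (hband : ∀ g, u g ≠ 0 → a ≤ borelHeight g ∧ borelHeight g ≤ b) :
    ∃ C : ℝ, ∀ g, ‖eisensteinSeriesU u g‖ ≤ C := by
  have ha2 : 0 < a / 2 := by positivity
  obtain ⟨C, -, hC⟩ := exists_const_norm_eisensteinSeriesU_le_cm L ha2
  refine ⟨C * M, fun g => hC u huB (fun g hg => ?_) M huM g⟩
  by_contra hu
  have h1 := (hband g hu).1
  have h2 : a / 2 < a := NNReal.half_lt_self ha.ne'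
  exact absurd (h1.trans hg) (not_le.2 h2)

/-- (δ5) **`quotFun (E u) ∈ L^p(𝔛, μ)`** for every finite measure `μ` on the automorphic quotient and every exponent `p` — the `hv` binder of the C7 HEAD's generators for the
Eisenstein class of a nice Borel-side function (bounded by (δ4), Borel by (δ3), ★ `memLp_quotFun_of_bound`). [cite: MoeglinWaldspurger1995, I.2.13, II.1.3] -/
theorem memLp_quotFun_eisensteinSeriesU_of_nice
    (μ : Measure (quasiSplit (↥(maximalRealSubfield L)) L (IsCMField.complexConj L) 2).automorphicQuotient) [IsFiniteMeasure μ] (p : ℝ≥0∞)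
    {u : (quasiSplit (↥(maximalRealSubfield L)) L (IsCMField.complexConj L) 2).Adelic → ℂ} (huc : Continuous u)
    (huB : ∀ b ∈ arithmeticBorel (↥(maximalRealSubfield L)) L (IsCMField.complexConj L) 2, ∀ g, u ((b : (quasiSplit (↥(maximalRealSubfield L)) L (IsCMField.complexConj L) 2).Adelic) * g) = u g)
    {M : ℝ} (huM : ∀ g, ‖u g‖ ≤ M) {a b : ℝ≥0} (ha : 0 < a) (hband : ∀ g, u g ≠ 0 → a ≤ borelHeight g ∧ borelHeight g ≤ b) :
    MemLp ((quasiSplit (↥(maximalRealSubfield L)) L (IsCMField.complexConj L) 2).quotFun (eisensteinSeriesU u)) p μ := by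
  obtain ⟨C, hC⟩ := exists_bound_eisensteinSeriesU_of_nice L huB huM ha hband
  exact memLp_quotFun_of_bound _ μ p hC (measurable_quotFun_eisensteinSeriesU_of_nice L huc huB huM ha hband).aestronglyMeasurable

end CM

end Summit.HodgeConjecture.HodgeConjecture.Cruxes.H413.K2E1EisensteinNiceClassCMTwo

end
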